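import Summits.BirchSwinnertonDyer.BirchSwinnertonDyer.Theorems.ManinLocalTwoThreeManinOfStevensConjectures
import Summits.BirchSwinnertonDyer.BirchSwinnertonDyer.Theorems.ManinLocalTwoThreeShimuraIndexNeNine
import HarnessLib

/-!
# C3 from Stevens' conjectures WITHOUT the index-`9` exclusion (sequel of `…ShimuraIndexNeNine`, route cone)

Summit `BirchSwinnertonDyer`, route `ManinLocalTwoThree` (cell bsd-f2-manin), crux C3 `ManinPrimeToThreeAtNine`
(stmt-BirchSwinnertonDyer-22968).  The LEAD's `maninPrimeToThreeAtNine_of_stevensConjectures` (p716357) derives the route declaration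
from F-need `hex`, Stevens' Conjectures I (`StevensConstantOne`) and II (`IsMaxCovolumeInClass` of Stevens' curve at `9 ∣ N`) and the
index-`9` exclusion «`Λ₁(f) ≠ 3Λ₀(f)`»; the exclusion is `periodLatticeGamma1_ne_three_mul_of_cusp_rational` (route-independent sibling
`…ShimuraIndexNeNine`, modulo `hex` and the printed F★ `optimalGamma1Parametrization_cusp_rational`), so:
**`maninPrimeToThreeAtNine_of_stevensConjectures_of_cusp_rational` — C3 ⟸ `hex` ∧ F★ ∧ Stevens I ∧ Stevens II.**
This file imports the route file's cone (it concludes the route declaration) and is kept minimal for that reason.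

HONEST FRAMING: a conditional reduction; `hex`, F★ and Stevens' conjectures are OPEN; C3, Manin's conjecture and BSD are NOT proved.
No definitions, no sorry; axioms standard.  References: G. Stevens, Invent. Math. 98 (1989), Conjectures I–III; B. Conrad,
B. Edixhoven, W. Stein, Doc. Math. 8 (2003) §6.
-/

set_option autoImplicit false
set_option linter.dupNamespace false

noncomputable section

open WeierstrassCurve Literature.NumberTheory.EllipticCurves Literature.NumberTheory.EllipticCurves.ModularForms
  Summit.BirchSwinnertonDyer.Rank1Residual.ManinAdditive.KatoCurve
  Summit.BirchSwinnertonDyer.Rank1Residual.ManinConstant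

namespace Summit.BirchSwinnertonDyer.BirchSwinnertonDyer.Theorems.ManinLocalTwoThree

/-- **C3 `ManinPrimeToThreeAtNine` ⟸ F-need `hex` ∧ F★ ∧ Stevens I ∧ Stevens II (at `9 ∣ N`)** — the LEAD's
`maninPrimeToThreeAtNine_of_stevensConjectures` with its fourth binder, the index-`9` exclusion, DISCHARGED by
`periodLatticeGamma1_ne_three_mul_of_cusp_rational`.  CONDITIONAL on the displayed open named facts / laws; BSD is not proved by this;
C3 OPEN. [cite: Stevens1989, Conjectures I–III] [cite: ConradEdixhovenStein2003, §6.1.2 and §6.2] -/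
theorem maninPrimeToThreeAtNine_of_stevensConjectures_of_cusp_rational (hex : exists_optimal_gamma1ParametrizationData)
    (hF : optimalGamma1Parametrization_cusp_rational) (hSt1 : StevensConstantOne)
    (hSt2 : ∀ (W₁ : WeierstrassCurve ℚ) [W₁.IsElliptic] [W₁.IsGloballyMinimal] {N : ℕ} [NeZero N]
      (D₁ : Gamma1ParametrizationData W₁ N), D₁.IsOptimal → 3 ^ 2 ∣ N → IsMaxCovolumeInClass W₁) :
    Summit.BirchSwinnertonDyer.BirchSwinnertonDyer.Theses.ManinLocalTwoThree.ManinPrimeToThreeAtNine :=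
  maninPrimeToThreeAtNine_of_stevensConjectures hex hSt1 hSt2
    (fun W₀ _ _ _ _ D₀ h₀ _ ↦ periodLatticeGamma1_ne_three_mul_of_cusp_rational hex hF W₀ D₀ h₀)

end Summit.BirchSwinnertonDyer.BirchSwinnertonDyer.Theorems.ManinLocalTwoThree

end
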